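import Summits.ABC.IUTFork.Thm311RealInd1StripGlobalStrictnessDyadic
import Summits.ABC.IUTFork.Joshi.TestRealPinsIsometricResidualLineGaussian
import Literature.IUT.LogVolume.GenuineLogThetaIdeles
import Literature.IUT.LogVolume.Corollary22TwoAdicIntegrality
import HarnessLib

/-!
# Row «C:PSI5-INPUT-WITNESS»: the binder class of R36 (ψ5) is INHABITED at the input level — a genuine Θ-volume input over the Gaussian field
# `ℚ(√−1) = CyclotomicField 4 ℚ` whose places over `2` all have local degree `2`; at it, R32 §1's global identity (P) FAILS AS TYPED (closed theorem)

Proof-only file of the abc-iut cell (GUARD ROW for R36 (ψ5); C LEAD ruling C-R218, executed by the live seat abc-iut-f-193 GEN 35 under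
GO-by-ruling; sibling of abc-iut-c312-1's `Thm311RealInd1StripGlobalStrictnessDyadic.lean` ★ p606976).  Statements about OUR typed inputs /
packets / reading (P) only; inhabited ≠ discharged; typed ≠ proved; calibrated ≠ discharged; TAKES NO SIDE on [IUTchIII] Cor. 3.12 /
[IUTchIV] Thm. 1.10, on reading (U) vs (P), or on any author; NO abc claim.

WHY.  R36 (ψ5) `ThetaVolumeInput.sum_lnνLp_hull_orbitH_ne_negLogThetaPerImageNonarch_of_dyadicSqrtNegOne` is a ∀-statement over
{`K ∋ √−1`, every section place over `2` of local degree `2`, `H ≤ indTwo` acting factorwise at one dyadic collection}; its binder class was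
shown inhabited PLACE-WISE only (R34° `DyadicSqrtNegOneWitness`, `ℚ₂(√−1)`).  This file gives ONE input-level inhabitant and instantiates
(ψ5) there BY NAME (no re-proof), so the census word «(P) fails as typed at the dyadic residual» is contentful, not possibly vacuous.

THE WITNESS (DICTIONARY).  `F₀ = K = CyclotomicField 4 ℚ` (`= ℚ(√−1)`; `s = ζ₄`, `s² = −1`, `[K:ℚ] = 2` — abc-iut-E-t47's
`PinsIsometricResidualLineGaussian.cyclotomicField_four_finrank_and_sq`); `Algebra K K` = the identity; section `σ` = ANY place section of
`K` over `K` (`PlaceSection.nonempty`, abc-iut's `CompletionLocalFields`) — every `σ.lift w`, `w ∣ 2`, is a place of `K` over `2`, hence has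
`e = 2`, `f = 1`, local degree `2` (`PinsIsometricResidualLineGaussian.ramificationIdx_eq_two_and_inertiaDeg_eq_one`); pilot data
`X = (j_E, S, l)` with `S = V(K)_2` (the dyadic place), `j_E = 2^{−5}` (so `ord_v(j_E) = −5·e_v < 0`, `ord_v(q_v) = 5·e_v`), `l = 5` (`ℓ⋆ = 2`);
the divisibility datum `(hq)` of abc-iut-w4-d037's `ThetaVolumeInput.exists_of_ordq` holds with `n = 1` (`1·e_v/e(v̲) = e_v/2 = 5e_v/(2·5)`
because `e(v̲) = 2`), which supplies the Θ- and `q`-ideles; `H ≡ ⊥` at every `(p, j, v⃗)` (admissible: `hH` by `bot_le`; `hHfac` with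
`δ ≡ AddEquiv.refl`, in the (Ind1) strip closure by `refl_mem_ind1StripOf`); collection `(i₁, v⃗₁) = (0, the constant collection at a chosen
place over 2)`.  The `H ≡ indTwo` variant is NOT filed here (> 60 extra lines: it needs the factorwise-action lemma at the genuine packet).

* §1 `exists_input_of_finrank_two_of_sq_eq_neg_one` — for ANY number field `K` with `[K:ℚ] = 2` and `s² = −1` in `K`: a genuine
  `I : ThetaVolumeInput K K` with `I.X.S = V(K)_2`, `I.X.l = 5` and every `I.σ.lift w`, `w ∣ 2`, of local degree `2`.
* §2 `exists_sum_lnνLp_hull_bot_ne_negLogThetaPerImageNonarch_gaussian` — CLOSED (no hypotheses): there is a genuine Θ-volume input over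
  `CyclotomicField 4 ℚ` at which, for the trivial family `H ≡ ⊥`, the prime-indexed nonarchimedean Θ-side sum in reading (P) is `≠`
  Dupuy–Hilado's `−|log(Θ)|^{(P),nonarch}` — (ψ5) BY NAME at the §1 witness; `_lt_` sibling likewise (`…_lt_…_gaussian`).

[cite: Mochizuki2012, IUTchIII Thm. 3.11 (i) p. 154; Cor. 3.12 p. 174] [cite: DupuyHilado2025, Def. 3.6.3, §4.11, §4.12]
[cite: NeukirchANT1999, Ch. I Prop. (8.2)] [claim: Mochizuki2012, status: disputed] for every IUT quotation.  PROOF-ONLY: no definition, no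
instance, no notation, no `Prop` fact; the witnesses live inside the proofs.
-/

set_option autoImplicit false

noncomputable section

open Metric Set Function Module
open scoped Pointwise TensorProduct

namespace Literature.IUT.LogVolume.ThetaVolumeInput

open Summit.ABC.IUTFork.Thm311.Real Literature.NumberTheory.NumberFields Function
open Literature.NumberTheory.GaloisRepresentations Literature.NumberTheory.GaloisRepresentations.Ultrametric
open Literature.AnabelianGeometry.AbsoluteAnabelian Literature.IUT.HodgeArakelov
open Literature.IUT.HodgeArakelov.AbsTopMonoids NumberField IsDedekindDomain
open Summit.ABC.IUTFork.Joshi.PinsIsometricResidualLineGaussian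

namespace DyadicWitness

/-! ## §1 A genuine Θ-volume input over a quadratic field containing `√−1`, with the dyadic local-degree-`2` section condition -/

/-- **Input-level inhabitant.**  For every number field `K` with `[K:ℚ] = 2` containing `s`, `s² = −1`: there is a genuine Θ-volume
input `I : ThetaVolumeInput K K` (base field `F₀ = K`, identity algebra, any place section) with bad places `S = V(K)_2`, `l = 5`,
`j_E = 2^{−5}`, and every section place over `2` of local degree `2` (`e = 2`, `f = 1`).  Ideles by abc-iut-w4-d037's
`ThetaVolumeInput.exists_of_ordq` (divisibility datum with `n = 1`). [cite: DupuyHilado2025, Def. 3.6.3, §3.3]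
[cite: NeukirchANT1999, Ch. I Prop. (8.2)] -/
theorem exists_input_of_finrank_two_of_sq_eq_neg_one {K : Type} [Field K] [NumberField K]
    (hK : Module.finrank ℚ K = 2) {s : K} (hs : s ^ 2 = -1) :
    ∃ I : ThetaVolumeInput K K, I.X.S = placesOver K 2 ∧ I.X.l = 5 ∧
      ∀ w : placesOver K 2, localDeg K (I.σ.lift w.1) = 2 := by
  classical
  obtain ⟨σ⟩ := PlaceSection.nonempty K K
  -- `e(v̲) = 2`, `f(v̲) = 1` at every section place over `2`
  have hef : ∀ w : placesOver K 2,
      (σ.lift w.1).asIdeal.ramificationIdx ℤ = 2 ∧ (σ.lift w.1).asIdeal.inertiaDeg ℤ = 1 := fun w =>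
    ramificationIdx_eq_two_and_inertiaDeg_eq_one hK hs _ (σ.natCast_mem_lift w)
  -- `ord_v(2^5) = 5·e_v` at every place over `2`
  have hord : ∀ v ∈ placesOver K 2, ord K v (((2 ^ 5 : ℕ) : K)) = 5 * ramIdx K v := by
    intro v hv
    rw [show ((2 ^ 5 : ℕ) : K) = ((2 : ℕ) : K) ^ 5 by push_cast; ring, ord_pow,
      Cor22.ord_natCast_eq_ramIdx 2 v hv]
    push_cast
    ring
  have hram : ∀ v : HeightOneSpectrum (𝓞 K), 0 < (ramIdx K v : ℤ) := fun v => by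
    exact_mod_cast Nat.pos_of_ne_zero (ramIdx_ne_zero K v)
  -- the pilot data `(j_E, S, l) = (2^{-5}, V(K)_2, 5)`
  let X : PilotData K :=
    { jE := (((2 ^ 5 : ℕ) : K))⁻¹
      S := placesOver K 2
      S_nonempty := placesOver_nonempty K 2
      ord_jE_neg := fun v hv => by
        rw [ord_inv, hord v hv]
        linarith [hram v]
      l := 5
      l_prime := by norm_num
      five_le_l := le_rfl }
  -- the divisibility datum `(hq)` with `n = 1`
  have hq : ∀ v ∈ X.S, ∃ n : ℤ,
      (n : ℝ) * (ramIdx K v : ℝ) / ((σ.lift v).asIdeal.ramificationIdx ℤ : ℝ) = (X.ordq v : ℝ) / (2 * X.l) := by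
    intro v hv
    have hv2 : v ∈ placesOver K 2 := hv
    have he : (σ.lift v).asIdeal.ramificationIdx ℤ = 2 := (hef ⟨v, hv2⟩).1
    have hordq : X.ordq v = 5 * ramIdx K v := by
      show -ord K v ((((2 ^ 5 : ℕ) : K))⁻¹) = _
      rw [ord_inv, hord v hv2]
      ring
    have hl : (X.l : ℝ) = 5 := by norm_num [X]
    refine ⟨1, ?_⟩
    rw [he, hordq, hl]
    push_cast
    ring
  obtain ⟨I, hIX, hIσ⟩ := ThetaVolumeInput.exists_of_ordq X σ hq
  refine ⟨I, by rw [hIX], by rw [hIX], fun w => ?_⟩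
  rw [hIσ, localDeg, (hef w).1, (hef w).2]

/-! ## §2 The closed instantiation of R36 (ψ5) over `ℚ(√−1) = CyclotomicField 4 ℚ`, trivial family `H ≡ ⊥` -/

/-- **R36 (ψ5)'s binder class INHABITED at the input level; (P) FAILS AS TYPED there (closed theorem, no hypotheses).**  There is a genuine
Θ-volume input `I` over `K = F₀ = ℚ(√−1) = CyclotomicField 4 ℚ` (bad places `S = V(K)_2`, `l = 5`, every section place over `2` of local
degree `2`) such that, for the TRIVIAL prime-indexed family `H ≡ ⊥` (admissible, `≤ indTwo`), the prime-indexed nonarchimedean Θ-side sum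
in reading (P) over `H` differs from Dupuy–Hilado's `−|log(Θ)|^{(P),nonarch}` — abc-iut-c312-1's R36 (ψ5)
`sum_lnνLp_hull_orbitH_ne_negLogThetaPerImageNonarch_of_dyadicSqrtNegOne` BY NAME at the §1 witness, `(i₁, v⃗₁) = (0, constant)`,
`hHfac` with `δ ≡ AddEquiv.refl`. [claim: Mochizuki2012, status: disputed]
[cite: Mochizuki2012, IUTchIII Thm. 3.11 (i) p. 154; Cor. 3.12 p. 174] [cite: DupuyHilado2025, Def. 3.6.3, §4.11, §4.12] -/
theorem exists_sum_lnνLp_hull_bot_ne_negLogThetaPerImageNonarch_gaussian :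
    ∃ I : ThetaVolumeInput (CyclotomicField 4 ℚ) (CyclotomicField 4 ℚ),
      I.X.S = placesOver (CyclotomicField 4 ℚ) 2 ∧ I.X.l = 5 ∧
      (∀ w : placesOver (CyclotomicField 4 ℚ) 2, localDeg (CyclotomicField 4 ℚ) (I.σ.lift w.1) = 2) ∧
      (∑ p ∈ I.supportPrimes, if hp : p.Prime then
          (haveI : Fact p.Prime := ⟨hp⟩
          (I.packetAt p hp).lnνLp I.lstar (fun j e =>
            packetHull p (fun b => (I.σ.localFields p).k (e b))
              (⋃ g : (⊥ : Subgroup (PacketAlgebra p (fun b => (I.σ.localFields p).k (e b)) ≃ₗ[ℚ_[p]]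
                  PacketAlgebra p (fun b => (I.σ.localFields p).k (e b)))),
                (g : PacketAlgebra p (fun b => (I.σ.localFields p).k (e b)) ≃ₗ[ℚ_[p]]
                  PacketAlgebra p (fun b => (I.σ.localFields p).k (e b))) ''
                (I.packetAt p hp).pilotRegion (I.tΘ p hp) j e))) else 0) ≠
        I.negLogThetaPerImageNonarch := by
  classical
  obtain ⟨hK, s, hs⟩ := cyclotomicField_four_finrank_and_sq
  obtain ⟨I, hS, hl, hd⟩ := exists_input_of_finrank_two_of_sq_eq_neg_one hK hs
  obtain ⟨v₂, hv₂⟩ := placesOver_nonempty (CyclotomicField 4 ℚ) 2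
  have hlstar : 0 < I.lstar := by
    show 0 < (I.X.l - 1) / 2
    rw [hl]
    norm_num
  let i₁ : Fin I.lstar := ⟨0, hlstar⟩
  let e₁ : Fin ((i₁ : ℕ) + 1 + 1) → placesOver (CyclotomicField 4 ℚ) 2 := fun _ => ⟨v₂, hv₂⟩
  refine ⟨I, hS, hl, hd, ?_⟩
  refine I.sum_lnνLp_hull_orbitH_ne_negLogThetaPerImageNonarch_of_dyadicSqrtNegOne hs hd (fun p hp j e => ⊥)
    (fun p hp j e => bot_le) i₁ e₁ ?_
  intro γ hγ
  rw [Subgroup.mem_bot] at hγ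
  subst hγ
  refine ⟨fun b => AddEquiv.refl _, fun b => AddSubgroup.subset_closure (refl_mem_ind1StripOf _ _), fun z => ?_⟩
  simp
  rfl

/-- The same witness, STRICT form: the Θ-side sum over `H ≡ ⊥` in reading (P) is STRICTLY BELOW `−|log(Θ)|^{(P),nonarch}` (R36 (ψ5)
`sum_lnνLp_hull_orbitH_lt_negLogThetaPerImageNonarch_of_dyadicSqrtNegOne` BY NAME). [claim: Mochizuki2012, status: disputed]
[cite: Mochizuki2012, IUTchIII Thm. 3.11 (i) p. 154; Cor. 3.12 p. 174] [cite: DupuyHilado2025, Def. 3.6.3, §4.11, §4.12] -/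
theorem exists_sum_lnνLp_hull_bot_lt_negLogThetaPerImageNonarch_gaussian :
    ∃ I : ThetaVolumeInput (CyclotomicField 4 ℚ) (CyclotomicField 4 ℚ),
      (∀ w : placesOver (CyclotomicField 4 ℚ) 2, localDeg (CyclotomicField 4 ℚ) (I.σ.lift w.1) = 2) ∧
      (∑ p ∈ I.supportPrimes, if hp : p.Prime then
          (haveI : Fact p.Prime := ⟨hp⟩
          (I.packetAt p hp).lnνLp I.lstar (fun j e =>
            packetHull p (fun b => (I.σ.localFields p).k (e b))
              (⋃ g : (⊥ : Subgroup (PacketAlgebra p (fun b => (I.σ.localFields p).k (e b)) ≃ₗ[ℚ_[p]]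
                  PacketAlgebra p (fun b => (I.σ.localFields p).k (e b)))),
                (g : PacketAlgebra p (fun b => (I.σ.localFields p).k (e b)) ≃ₗ[ℚ_[p]]
                  PacketAlgebra p (fun b => (I.σ.localFields p).k (e b))) ''
                (I.packetAt p hp).pilotRegion (I.tΘ p hp) j e))) else 0) <
        I.negLogThetaPerImageNonarch := by
  classical
  obtain ⟨hK, s, hs⟩ := cyclotomicField_four_finrank_and_sq
  obtain ⟨I, hS, hl, hd⟩ := exists_input_of_finrank_two_of_sq_eq_neg_one hK hs
  obtain ⟨v₂, hv₂⟩ := placesOver_nonempty (CyclotomicField 4 ℚ) 2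
  have hlstar : 0 < I.lstar := by
    show 0 < (I.X.l - 1) / 2
    rw [hl]
    norm_num
  let i₁ : Fin I.lstar := ⟨0, hlstar⟩
  let e₁ : Fin ((i₁ : ℕ) + 1 + 1) → placesOver (CyclotomicField 4 ℚ) 2 := fun _ => ⟨v₂, hv₂⟩
  refine ⟨I, hd, ?_⟩
  refine I.sum_lnνLp_hull_orbitH_lt_negLogThetaPerImageNonarch_of_dyadicSqrtNegOne hs hd (fun p hp j e => ⊥)
    (fun p hp j e => bot_le) i₁ e₁ ?_
  intro γ hγ
  rw [Subgroup.mem_bot] at hγ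
  subst hγ
  refine ⟨fun b => AddEquiv.refl _, fun b => AddSubgroup.subset_closure (refl_mem_ind1StripOf _ _), fun z => ?_⟩
  simp
  rfl

end DyadicWitness

end Literature.IUT.LogVolume.ThetaVolumeInput

end
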